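import Summits.BirchSwinnertonDyer.Rank1Residual.X11b.BDPRouteOddOnTree
import HarnessLib

/-!
# Class X11b, route "BDP + converse-theorem engine + Kolyvagin" (p2): THE open input at every ODD
# prime as a NAMED predicate, and the odd-prime records stated with it (cell `b2b-bsdres`,
# sub-cell `multr1-p2`, gen 18)

HONEST FRAMING (verbatim, cell `b2b-bsdres`, run/shared/lean/b2b/bsd-rank1-residual/): the goal of
the cell is to DELETE the COMBINATION-SHAPED residual classes for ALL analytic-rank `≤ 1` curves
over `ℚ` — "full BSD formula for every rank `≤ 1` curve in class `C`" assembled STRICTLY from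
published theorems — so that the rank-`≤ 1` remainder becomes exactly the CONSTRUCTION-SHAPED
classes, which are TYPED (missing-input Props), NOT attempted; this is not "finishing BSD".
Research route `p2` for class X11b; no claim beyond the stated class and loci; nothing booked;
X11b stays CONSTRUCTION-SHAPED. ONE `Prop`-valued PREDICATE on `(W, p)` (nothing asserted) and
theorems; no named fact; no `sorry`.

## What this file does

`BDPRouteOddOnTree.lean` (theorems only) proves the route's record at EVERY odd prime with THE open
input stated INLINE. This companion NAMES that binder — `P2OpenInputOnTreeOddAt W p`, verbatim the
gen-11 predicate `P2OpenInputOnTreeAt W p` (`BDPRouteRecord.lean`) with its antecedent `5 ≤ p`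
removed — records its relation to the `p ≥ 5` predicate (`p2OpenInputOnTreeAt_of_odd`,
`p2OpenInputOnTreeOddAt_iff_of_five_le`), and restates the odd-prime theorems with it:
`P2.missingLowerBoundAt_of_openInputOddAt` (one pair), **`P2.bsdp_of_onTree_algebraic_odd`**
(`∀ (E,p) ∈` X11b, `p` odd `→ BSD(E,p)` ⇐ twelve published named facts + the odd open input + (T2′) +
(T4″); NO control / Selmer-count / Néron input) and `P2.bsdp_three_of_onTree` (the `p = 3` row; the
open input at `p = 3` has no source and no announcement). CONDITIONAL; nothing booked; labels
UNCHANGED (X11 ∧ `r = 1` at `p = 3` stays CONSTRUCTION-SHAPED).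

References: [Castella2018] Thm. 2.3 (arXiv:1704.06608 p. 5), Thm. 3.2 (p. 9); [Castella2018Erratum]
(2.4); [JetchevSkinnerWan2017] §7.4.1; [Skinner2016PacificMC] Thm. C and footnote 1; [Wuthrich2014]
Prop. 21; [MilneADT2006] I 2.8, 4.10(b); [Miller2011LMS] Def. 1.1.
-/

noncomputable section

open scoped Classical

open WeierstrassCurve NumberField IsDedekindDomain Field
open Literature.NumberTheory.EllipticCurves Literature.NumberTheory.EllipticCurves.GreenbergSelmer
  Literature.NumberTheory.EllipticCurves.ModularForms
  Literature.NumberTheory.EllipticCurves.Rank1Residual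
  Literature.NumberTheory.EllipticCurves.Rank1Residual.Typed
  Literature.NumberTheory.EllipticCurves.Wuthrich2014
  Literature.NumberTheory.EllipticCurves.BalakrishnanEtAl2019
  Literature.NumberTheory.QuadraticFields.Quadratic
  Literature.NumberTheory.Automorphic
  Literature.NumberTheory.GaloisRepresentations Literature.NumberTheory.GaloisCohomology
  Summit.BirchSwinnertonDyer.Rank1Residual.X11b.AcSelmer
  Summit.BirchSwinnertonDyer.Rank1Residual.X11b.LocBridge

namespace Summit.BirchSwinnertonDyer.Rank1Residual.X11b

/-! ### THE open input without the antecedent `5 ≤ p` -/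

/-- **(T1ᵗ-IMC) at EVERY ODD PRIME — THE open input of route p2 with the antecedent `5 ≤ p`
removed, every symbol a tree object — OPEN.** At every X11b pair (so `p ≠ 2`) with `ρ̄_{E,p}` onto,
and every odd-`d_K` Heegner datum as in `P2OpenInputOnTreeAt` (`K` imaginary quadratic Heegner for
`N_E`, `d_K` odd, `p ∤ d_K`, `p ∤ #𝓞_K^×`, `L(E^{d_K},1) ≠ 0`, a parametrisation datum with `p ∤ c`,
its Heegner point `P` of infinite order), for every anticyclotomic `κ`, generator `γ` and degree-one
`𝔭 ∋ p` with THE embedding `embAt`: `IMCLowerWaldspurgerOnTreeAt` — "`Ch_Λ(X_ac(E[p^∞])) ⊆ (L_p(f))`"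
at `𝟙` composed with the BDP formula at `p ∣ N`, i.e. `2·(ord_p log_ω P − 1) ≤ ord_p f_ac(0)`. For
`p ≥ 5` this is `P2OpenInputOnTreeAt` (`p2OpenInputOnTreeOddAt_iff_of_five_le`) [erratum (2.4) ⇐
FW21 Thm. 4.41, UNREFEREED]; at `p = 3` NO source or announcement exists (Skinner–Zhang 2014, the
erratum's Thm. A′ and BSTW all assume `p > 3`) — nothing is claimed. A predicate on `(W, p)`; NEVER a
theorem in this cell; every result using it is CONDITIONAL. [claim: Castella2018Erratum, status: under-review]
[cite: Castella2018, Thm. 3.2 (arXiv:1704.06608 p. 9) (shape only; nothing asserted)] -/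
def P2OpenInputOnTreeOddAt (W : WeierstrassCurve ℚ) [W.IsElliptic] [W.IsGloballyMinimal] (p : ℕ)
    [Fact p.Prime] : Prop :=
  ∀ (N : ℕ) [NeZero N] (K : Type) [Field K] [NumberField K]
    (Dt : ModularParametrizationData W N) (H : HeegnerDatum N (NumberField.discr K)) (ι : K →+* ℂ)
    (P : (W.baseChange K).toAffine.Point),
    ClassX11b W p → Surj W p → W.conductorNorm ℤ = N → IsImaginaryQuadratic K →
    Odd (NumberField.discr K) → ¬ (p : ℤ) ∣ NumberField.discr K → ¬ p ∣ Units.torsionOrder K →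
    SatisfiesHeegnerHypothesis N K →
    (W.quadraticTwist (NumberField.discr K : ℚ)).entireLFunction 1 ≠ 0 →
    WeierstrassCurve.Affine.Point.map ι.toRatAlgHom P = heegnerPointComplex Dt H →
    ¬ (p : ℤ) ∣ Dt.c → ¬ IsOfFinAddOrder P →
    ∀ (κ : ZpExtension K p), κ.IsAnticyclotomic →
      ∀ (γ : Field.absoluteGaloisGroup K) [Fact (κ.IsTopGenerator γ)]
        (𝔭 : HeightOneSpectrum (𝓞 K)) (h𝔭 : ((p : ℕ) : 𝓞 K) ∈ 𝔭.asIdeal)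
        (he : 𝔭.asIdeal.ramificationIdx (𝓞 ℚ) = 1) (hf : 𝔭.asIdeal.inertiaDeg (𝓞 ℚ) = 1),
        IMCLowerWaldspurgerOnTreeAt p κ 𝔭 γ (embAt K p 𝔭 h𝔭 he hf) P

section OddInput

variable {W : WeierstrassCurve ℚ} [W.IsElliptic] [W.IsGloballyMinimal] {p : ℕ} [Fact p.Prime]

/-- The odd-prime form implies the `p ≥ 5` form (drop the antecedent). [folklore] -/
theorem p2OpenInputOnTreeAt_of_odd (h : P2OpenInputOnTreeOddAt W p) : P2OpenInputOnTreeAt W p :=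
  fun N _ K _ _ Dt H ι P hX _ hs hN hK hodd hpd hμ hHN hLt hP hc hPinf κ hκ γ _ 𝔭 h𝔭 he hf ↦
    h N K Dt H ι P hX hs hN hK hodd hpd hμ hHN hLt hP hc hPinf κ hκ γ 𝔭 h𝔭 he hf

/-- For `p ≥ 5` the two forms of the open input are equivalent. [folklore] -/
theorem p2OpenInputOnTreeOddAt_iff_of_five_le (hp5 : 5 ≤ p) :
    P2OpenInputOnTreeOddAt W p ↔ P2OpenInputOnTreeAt W p :=
  ⟨p2OpenInputOnTreeAt_of_odd,
    fun h N _ K _ _ Dt H ι P hX hs hN hK hodd hpd hμ hHN hLt hP hc hPinf κ hκ γ _ 𝔭 h𝔭 he hf ↦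
      h N K Dt H ι P hX hp5 hs hN hK hodd hpd hμ hHN hLt hP hc hPinf κ hκ γ 𝔭 h𝔭 he hf⟩

end OddInput

/-! ### The odd-prime records with the named input -/

section Odd

variable (W : WeierstrassCurve ℚ) [W.IsElliptic] [W.IsGloballyMinimal] (p : ℕ) [Fact p.Prime]

/-- **The main-conjecture half at ONE X11b pair, ANY ODD `p`, `ρ̄_{E,p}` onto, from
`P2OpenInputOnTreeOddAt W p`** — `missingLowerBoundAt_of_classX11b_of_surj_of_openInput_odd` with the
named input. CONDITIONAL on the open input; nothing booked. [cite: Wuthrich2014, Prop. 21 (p. 400)]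
[cite: JetchevSkinnerWan2017, §7.4.1 (pp. 30–31)] [cite: Castella2018, Thm. 2.3 (p. 5), Thm. 3.2 (p. 9)] [cite: Miller2011LMS, Def. 1.1] -/
theorem P2.missingLowerBoundAt_of_openInputOddAt
    (hGZ : ∀ (N : ℕ) [NeZero N] (W : WeierstrassCurve ℚ) (K : Type) [Field K] [NumberField K],
      gross_zagier N W K)
    (hKo : ∀ (N : ℕ) [NeZero N] (W : WeierstrassCurve ℚ) (K : Type) [Field K] [NumberField K],
      kolyvagin N W K)
    (hWu : sha_dvd_analyticSha)
    (hGZK : rank_eq_analyticRank_of_analyticRank_le_one) (hmod : hasEntireLFunction_rat)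
    (hnf : exists_isNewformOf) (hHL : HoffsteinLuo1997_exists_twist_L_one_ne_zero)
    (hMaz : mazur_not_dvd_maninConstant_of_odd)
    (hPT : ∀ (K : Type) [Field K] [NumberField K], poitouTate_sum_localTatePairing_eq_zero K)
    (hEP : ∀ (K : Type) [Field K] [NumberField K] (v : HeightOneSpectrum (𝓞 K)),
      localEulerPoincareCharacteristic (v.adicCompletion K))
    (hA : P2OpenInputOnTreeOddAt W p) (hX : ClassX11b W p) (hsurj : Surj W p) :
    Typed.MissingLowerBoundAt W p :=
  missingLowerBoundAt_of_classX11b_of_surj_of_openInput_odd W p hGZ hKo hWu hGZK hmod hnf hHL hMaz hPT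
    hEP hA hX hsurj

/-- **Route p2 at EVERY ODD PRIME — statement of record with the named open input, `p = 3`
included.** `∀ (E, p) ∈` X11b (`p` odd) `→ BSD(E, p)` from TWELVE published named facts
(Gross–Zagier, Kolyvagin ×2, Skinner 2016 Thm. C [`p ≥ 3`, footnote 1], Wuthrich 2014 Prop. 21, GZK,
modularity ×2, Hoffstein–Luo, Mazur 1978 Cor. 4.1, Poitou–Tate, local Euler characteristic) and the
typed inputs (T1ᵗ-IMC, odd) `P2OpenInputOnTreeOddAt` [for `p ≥ 5`: erratum (2.4) ⇐ FW21 4.41,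
UNREFEREED; at `p = 3`: no source], (T2′) the Euler-system half off the unconditional atom
`(ram) ∧ p ∤ ∏c`, (T4″) the non-surjective corner on `p ∣ ord_p Δ_min ∧ ¬(ram)`. NO control input,
NO Selmer-count input, NO Néron binder, NO `5 ≤ p` (`bsdp_of_classX11b_odd_of_onTreeInputs`).
CONDITIONAL; nothing booked; labels UNCHANGED. [cite: JetchevSkinnerWan2017, §7.4.1–7.4.3 (pp. 30–31), Prop. 3.2.1]
[cite: Castella2018, Thm. 2.3 (p. 5), (3.2.1), Thm. 3.2 (p. 9)] [cite: Castella2018Erratum, (2.4) (p. 1)]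
[cite: Skinner2016PacificMC, Thm. C (§1) and footnote 1] [cite: McCallumLMS1991, §1 Theorem (Kolyvagin), p. 296]
[cite: Wuthrich2014, Prop. 21 (p. 400)] [cite: MilneADT2006, Ch. I, Thm. 4.10(b) and Thm. 2.8] [cite: Miller2011LMS, Def. 1.1] -/
theorem P2.bsdp_of_onTree_algebraic_odd
    (hGZ : ∀ (N : ℕ) [NeZero N] (W : WeierstrassCurve ℚ) (K : Type) [Field K] [NumberField K],
      gross_zagier N W K)
    (hKo : ∀ (N : ℕ) [NeZero N] (W : WeierstrassCurve ℚ) (K : Type) [Field K] [NumberField K],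
      kolyvagin N W K)
    (hB : ∀ (N : ℕ) [NeZero N] (W : WeierstrassCurve ℚ) (K : Type) [Field K] [NumberField K],
      Kolyvagin1990_padicValNat_card_sha_le N W K)
    (hSk : Skinner2016.thmC_padicValRat_bsd_rank_zero) (hWu : sha_dvd_analyticSha)
    (hGZK : rank_eq_analyticRank_of_analyticRank_le_one) (hmod : hasEntireLFunction_rat)
    (hnf : exists_isNewformOf) (hHL : HoffsteinLuo1997_exists_twist_L_one_ne_zero)
    (hMaz : mazur_not_dvd_maninConstant_of_odd)
    (hPT : ∀ (K : Type) [Field K] [NumberField K], poitouTate_sum_localTatePairing_eq_zero K)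
    (hEP : ∀ (K : Type) [Field K] [NumberField K] (v : HeightOneSpectrum (𝓞 K)),
      localEulerPoincareCharacteristic (v.adicCompletion K))
    -- (T1ᵗ-IMC, odd) THE open input
    (hA : ∀ (W : WeierstrassCurve ℚ) [W.IsElliptic] [W.IsGloballyMinimal] (p : ℕ) [Fact p.Prime],
      P2OpenInputOnTreeOddAt W p)
    -- (T2′) the Euler-system half off the unconditional atom (ram) ∧ `p ∤ ∏ c_ℓ`
    (hU : ∀ (W : WeierstrassCurve ℚ) [W.IsElliptic] [W.IsGloballyMinimal] (p : ℕ) [Fact p.Prime],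
      ClassX11b W p → Surj W p → ¬ (Ram W p ∧ ¬ p ∣ W.tamagawaProduct) →
        Typed.MissingUpperBoundAt W p)
    -- (T4″) the non-surjective corner, localised: `p ∣ ord_p Δ_min`, no (ram) prime
    (hC : ∀ (W : WeierstrassCurve ℚ) [W.IsElliptic] [W.IsGloballyMinimal] (p : ℕ) [Fact p.Prime],
      ClassX11b W p → ¬ Surj W p → p ∣ padicValInt p W.minimalDiscriminantInt → ¬ Ram W p →
        Typed.MissingPPartAt W p)
    (W : WeierstrassCurve ℚ) [W.IsElliptic] [W.IsGloballyMinimal] (p : ℕ) [Fact p.Prime]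
    (hX : ClassX11b W p) : BSDp W p :=
  bsdp_of_classX11b_odd_of_onTreeInputs hGZ hKo hB hSk hWu hGZK hmod hnf hHL hMaz hPT hEP
    (fun W _ _ p _ ↦ hA W p) hU hC W p hX

/-- **The `p = 3` row with the named input**: `∀ E` with `(E,3) ∈` X11b `→ BSD(E,3)` ⇐ the twelve
published facts + `P2OpenInputOnTreeOddAt W 3` [NO source, not even announced] + (T2′)@3 + (T4″)@3
(`bsdp_of_classX11b_three_of_onTreeInputs`). CONDITIONAL; nothing booked; X11 ∧ `r = 1` at `p = 3`
stays CONSTRUCTION-SHAPED. [cite: Castella2018, Thm. 2.3 (p. 5), Thm. 3.2 (p. 9)]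
[cite: Skinner2016PacificMC, Thm. C (§1) and footnote 1] [cite: Wuthrich2014, Prop. 21 (p. 400)] [cite: Miller2011LMS, Def. 1.1] -/
theorem P2.bsdp_three_of_onTree [Fact (Nat.Prime 3)]
    (hGZ : ∀ (N : ℕ) [NeZero N] (W : WeierstrassCurve ℚ) (K : Type) [Field K] [NumberField K],
      gross_zagier N W K)
    (hKo : ∀ (N : ℕ) [NeZero N] (W : WeierstrassCurve ℚ) (K : Type) [Field K] [NumberField K],
      kolyvagin N W K)
    (hB : ∀ (N : ℕ) [NeZero N] (W : WeierstrassCurve ℚ) (K : Type) [Field K] [NumberField K],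
      Kolyvagin1990_padicValNat_card_sha_le N W K)
    (hSk : Skinner2016.thmC_padicValRat_bsd_rank_zero) (hWu : sha_dvd_analyticSha)
    (hGZK : rank_eq_analyticRank_of_analyticRank_le_one) (hmod : hasEntireLFunction_rat)
    (hnf : exists_isNewformOf) (hHL : HoffsteinLuo1997_exists_twist_L_one_ne_zero)
    (hMaz : mazur_not_dvd_maninConstant_of_odd)
    (hPT : ∀ (K : Type) [Field K] [NumberField K], poitouTate_sum_localTatePairing_eq_zero K)
    (hEP : ∀ (K : Type) [Field K] [NumberField K] (v : HeightOneSpectrum (𝓞 K)),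
      localEulerPoincareCharacteristic (v.adicCompletion K))
    (hA : ∀ (W : WeierstrassCurve ℚ) [W.IsElliptic] [W.IsGloballyMinimal], P2OpenInputOnTreeOddAt W 3)
    (hU : ∀ (W : WeierstrassCurve ℚ) [W.IsElliptic] [W.IsGloballyMinimal],
      ClassX11b W 3 → Surj W 3 → ¬ (Ram W 3 ∧ ¬ 3 ∣ W.tamagawaProduct) →
        Typed.MissingUpperBoundAt W 3)
    (hC : ∀ (W : WeierstrassCurve ℚ) [W.IsElliptic] [W.IsGloballyMinimal],
      ClassX11b W 3 → ¬ Surj W 3 → 3 ∣ padicValInt 3 W.minimalDiscriminantInt → ¬ Ram W 3 →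
        Typed.MissingPPartAt W 3)
    (W : WeierstrassCurve ℚ) [W.IsElliptic] [W.IsGloballyMinimal] (hX : ClassX11b W 3) :
    BSDp W 3 :=
  bsdp_of_classX11b_three_of_onTreeInputs hGZ hKo hB hSk hWu hGZK hmod hnf hHL hMaz hPT hEP
    (fun W _ _ ↦ hA W) hU hC W hX

end Odd

end Summit.BirchSwinnertonDyer.Rank1Residual.X11b

end
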